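import Summits.QuantumFields.YangMills.Theorems.BalabanUVNodesN15KingModelJetLettersColour
import Summits.QuantumFields.YangMills.Theorems.BalabanUVNodesN15TwoGridMeanZeroMultiplierL2
import Summits.QuantumFields.YangMills.Theorems.BalabanUVNodesN15KingModelFullPropagatorL2LocalSecondOrderSix
import HarnessLib

/-!
# BalabanUVNodes ∕ N15 — THE KING-MODEL RUNG, PROGRAMME Y (the dressed SOURCE-DIVERGENCE entry of the King jet), FILE 64:
# THE CELL-OSCILLATION ROW OF `A₀⁻¹N∇*_ν` IN (coarse sup-block → fine L²-block) CURRENCY —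
# `(A₀′⁻¹N′∇′*_ν ⊗ 1)∘𝔇_{kingPrV}(M_{c′}, M_{blockAvg c′}) ≤ C·r·(L^K)⁻¹·e^{−δ|y−y′|_T}`, NO letter on `∇c′`, uniform in `K`, the refinement `n`, the volume and the mass

WHO ∕ WHEN.  Cell `pub-ymgap`, seat `pub-ymgap-dag-n15-d` (R134, N15 NE2 s3 = King-model rung, g22); `--kind proof --supports stmt-QuantumFields-27366 --as helper`
(K3⁸; count-neutral).  THEOREMS ONLY (0 `def`).  Over dag-n15-e Υ-c `fullPropAdjHessOp_l2_local` ((3.46)₆ localised for King's full `A = 0` propagator: the `L²`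
size of `h·A₀⁻¹N²∇*_μ∇*_νλ`), dag-n15-a K-E `hasMaj_comp_idef_mulOp_blockAvg_of_divAdj_l2` (the mean-zero-multiplier mechanism with the divergence rows read in
`L²`-block currency) and K-A `tensorId_kingGOp_comp_symbOp_divAdj` (dictionary) BY NAME; nothing in the tree is modified.

WHY (this seat's ARCHITECTURE NOTE «ENTRY 2 LIVE BY PARTS», pub-ymgap INBOX l.43300).  In dag-n15-a's K-D′ family (`ne2PlusOperator_kingJet_covariant`) the
third entry of (3.42) — `G∇*` — is still the rung's `U ≡ 1` η-defect.  Its dressed version `Y_κ = X∘N∇*_κ` obeys, after ONE lattice Leibniz step, the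
fixed-point equation `Y = A₀⁻¹N∇*_κ + [A₀⁻¹∘M_{c−Σb} + Σ_μ (A₀⁻¹N∇_μ)∘M_{ã_μ}]Y` in which no derivative meets `Y` and the rough letter `c′` only meets `A₀⁻¹`
on its left; the ONE row of that equation's η-defect not in the tree is the CELL-OSCILLATION ROW OF THE SOURCE-DIFFERENCED PROPAGATOR
`(A₀′⁻¹N′∇′_μ)∘𝔇(M_{a′}, M_{blockAvg a′})` — a pure second SOURCE difference of `A₀′⁻¹` summed over cells (dag-n15-d g21: no pointwise kernel theory in the
tree; the kernel is logarithmic at the edges of the `Q*Q` blocks).  THIS FILE types it in `L²`-block currency WITHOUT any kernel bound: dag-n15-a's mechanism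
writes the cell-oscillating multiplier as an exact fine divergence of line antiderivatives of size `(L^K)⁻¹·sup` (M-B), so behind `A₀′⁻¹N′∇′*_ν` it costs the
DOUBLE-DIVERGENCE rows `A₀′⁻¹N′²∇′*_ν∇′*_κ`, which are dag-n15-e's (3.46)₆ `L²` interior-regularity theorem.  The sup upgrade (part 70 interpolation against
dag-n15-e W-b's Hölder steps of `A₀⁻¹∇*`) is FILE 65; the mirror orientation `A₀⁻¹N∇_μ` (forward source difference) is FILE 66 (block-face reflection).

WHAT.  §1 `sum_sq_filter_prod_eq` (the `L²`-block sum on the coloured carrier is the colour sum of the scalar block sums), `kingSOp_divAdj_colour_apply`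
(`((A₀⁻¹N∇*_ν ⊗ 1)∘ρ(N(s_κ⁻¹ − 1)))f (x, i) = (A₀⁻¹(N²∇*_ν∇*_κ f(·, i)))(x)`), ★ `hasMajL2_tensorId_kingSOp_comp_divAdj` (Υ-c read as
`HasMaj (l2Blocks) (l2Blocks) ((kingSOp′_ν ⊗ 1)∘ρ(N′(s_κ⁻¹−1))) (C·e^{−δ|y−y′|_T})` on the fine coloured carrier, every `K ≥ 1`, `n`, volume, `0 < m² ≤ m₀²`);
§2 ★★ `hasMajL2_kingSOp_comp_idef_mulOp_blockAvg`: `HasMaj (ofBlocks (unitTorusGeo L K M) (blkFine L K M)) (l2Blocks … (blockOf (L^n·L^K) M ∘ fst) (η′^{d+1}))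
((kingSOp′_ν ⊗ 1)∘𝔇_{kingPrV}(M_{c′}, M_{blockAvg c′})) (C·r·(L^K)⁻¹·e^{−δ|y−y′|_T})` for `|c′| ≤ r` — HYPOTHESIS-FREE, uniform in `n`.

HONEST FRAMING ∕ LIMITS.  King's `A = 0` MODEL on finite tori (template literature [King1986] (2.13)–(2.17) p.653, (4.1)–(4.5) p.670), abelianised scalar
multipliers — NOT Bałaban's covariant `G(U)`; the OUTPUT is measured in the `L²`-block norm (the sup row is FILE 65); [Balaban1985BackgroundPropagators]
(3.42) p.397 ∕ (3.46) p.398 ∕ (3.52) p.400 cited as SHAPE only.  NE2⁺ NOT PRINTED ∕ NOT proved; no statement of record touched; N15 NOT discharged; K3⁸ OPEN;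
counts UNMOVED (typed 28∕28 · discharged 5∕27); one finite torus per index — NOT ℝ⁴ ∕ infinite volume ∕ OS ∕ mass gap ∕ Clay.
-/

noncomputable section

open scoped BigOperators Matrix
open Finset

namespace Summit.QuantumFields.YangMills.BalabanUVNodes.N15.KingModel.SrcDiv

open Literature.MathematicalPhysics.QuantumFieldTheory.Balaban1983to89
open Literature.MathematicalPhysics.QuantumFieldTheory.Balaban1983to89.B11SectG (BlockNorm HasMaj)
open Literature.MathematicalPhysics.QuantumFieldTheory.Balaban1983to89.T4EtaRateDefect (idef idef_apply)
open Literature.MathematicalPhysics.QuantumFieldTheory.Balaban1983to89.T4EtaRateCoeffDefect (pull pull_apply blockAvg)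
open Literature.MathematicalPhysics.QuantumFieldTheory.Balaban1983to89.B6Prop26Gluing (mulOp mulOp_apply)
open Literature.MathematicalPhysics.QuantumFieldTheory.Balaban1983to89.B5Prop11Plancherel (Tor fine unitVec)
open Literature.MathematicalPhysics.QuantumFieldTheory.Balaban1983to89.B5SettingP12Weighted (etaPow etaPow_nonneg)
open Literature.MathematicalPhysics.QuantumFieldTheory.King1986 (aK)
open Literature.MathematicalPhysics.QuantumFieldTheory.King1986.Torus (fineOp blockOf tdistT tdistT_nonneg)
open Literature.MathematicalPhysics.QuantumFieldTheory.Balaban1983to89.B6UnitTorusCarrier (unitTorusGeo)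
open Summit.QuantumFields.YangMills.BalabanUVNodes.N15.VectorPiece (kingPrV blkFine tensorId tensorId_apply)
open Summit.QuantumFields.YangMills.BalabanUVNodes.N15.TwoGrid (symbOp sTinv symbOp_sTinv_apply hasMaj_comp_idef_mulOp_blockAvg_of_divAdj_l2 sq_loc_l2Blocks loc_l2Blocks_eq)
open Summit.QuantumFields.YangMills.BalabanUVNodes.N15.TwoGrid.KingJet (tensorId_kingGOp_comp_symbOp_divAdj)
open Summit.QuantumFields.YangMills.BalabanUVNodes.N15KingModelRung.Curved (kingGOp kingSOp kingGOp_apply kingSOp_apply fullPropAdjHessOp_l2_local)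

variable {d : ℕ} (L : ℕ) [NeZero L]

/-! ## §1 Υ-c read as an `L²`-block majorant of `(A₀⁻¹N∇*_ν ⊗ 1)∘ρ(N(s_κ⁻¹ − 1))` on the coloured fine carrier -/

section DivRows

variable (N : ℕ) [NeZero N] (M : Fin (d + 1) → ℕ) [∀ μ, NeZero (M μ)]

omit [NeZero L] in
/-- The `L²`-block sum on the coloured carrier `T × Fin (d+1)` (blocks read through the first coordinate) is the colour sum of the scalar block sums.
[folklore] -/
theorem sum_sq_filter_prod_eq (y : Tor M) (F : Tor (fine N M) × Fin (d + 1) → ℝ) :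
    ∑ p ∈ univ.filter (fun p : Tor (fine N M) × Fin (d + 1) => blockOf N M p.1 = y), F p ^ 2
      = ∑ i : Fin (d + 1), ∑ x ∈ univ.filter (fun x : Tor (fine N M) => blockOf N M x = y), F (x, i) ^ 2 := by
  classical
  have hset : univ.filter (fun p : Tor (fine N M) × Fin (d + 1) => blockOf N M p.1 = y)
      = (univ.filter (fun x : Tor (fine N M) => blockOf N M x = y)) ×ˢ (univ : Finset (Fin (d + 1))) := by
    ext p
    simp
  rw [hset, sum_product, sum_comm]

omit [NeZero L] in
/-- Pointwise form of the divergence rows of the third entry: `((A₀⁻¹N∇*_ν ⊗ 1)∘ρ(N(s_κ⁻¹ − 1)))f (x, i) = (A₀⁻¹(N²∇*_ν∇*_κ f(·, i)))(x)` with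
`N²∇*_ν∇*_κ g (z) = N²(g(z − e_ν − e_κ) − g(z − e_ν) − g(z − e_κ) + g(z))` — dag-n15-e Υ-c's object. [folklore]
[cite: Balaban1985BackgroundPropagators, Thm 3.1 (3.46) p.398 (sixth entry, shape); King1986, (4.1)–(4.5) p.670] -/
theorem kingSOp_divAdj_colour_apply (a msq : ℝ) (K : ℕ) (ν κ : Fin (d + 1)) (f : Tor (fine N M) × Fin (d + 1) → ℝ) (p : Tor (fine N M) × Fin (d + 1)) :
    (tensorId (Fin (d + 1)) (kingSOp L a msq K N M ν) ∘ₗ symbOp M N (((N : ℕ) : ℝ) • (sTinv M N κ - 1))) f p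
      = ((fineOp N M (aK a L K) (((N : ℕ) : ℝ) ^ 2) msq)⁻¹ *ᵥ
          (fun z => (N : ℝ) ^ 2 * (f (z - unitVec (fine N M) ν - unitVec (fine N M) κ, p.2) - f (z - unitVec (fine N M) ν, p.2)
            - f (z - unitVec (fine N M) κ, p.2) + f (z, p.2)))) p.1 := by
  have hg : ∀ y, symbOp M N (((N : ℕ) : ℝ) • (sTinv M N κ - 1)) f (y, p.2) = ((N : ℕ) : ℝ) * (f (y - unitVec (fine N M) κ, p.2) - f (y, p.2)) := by
    intro y
    rw [map_smul, map_sub, map_one, LinearMap.smul_apply, LinearMap.sub_apply, Pi.smul_apply, Pi.sub_apply, smul_eq_mul, symbOp_sTinv_apply]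
    rfl
  rw [LinearMap.comp_apply, tensorId_apply, kingSOp_apply]
  congr 1
  funext z
  rw [hg, hg]
  ring

end DivRows

section Main

variable {L}

/-- ★ **THE DIVERGENCE ROWS OF THE THIRD ENTRY IN `L²`-BLOCK CURRENCY — dag-n15-e Υ-c `fullPropAdjHessOp_l2_local` read as a block majorant.**  For odd `L ≥ 3`,
`a > 0`, a mass cap `m₀² ≥ 0`: `∃ C δ > 0` such that for every `K ≥ 1`, refinement `n`, cube `M_μ = 2L^e`, mass `0 < m² ≤ m₀²` and directions `ν, κ`, on the
fine coloured carrier `Tor (fine (L^n·L^K) M) × Fin (d+1)` (King's unit blocks `blockOf (L^n·L^K) M ∘ fst`, weight `η′^{d+1}`):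
`HasMaj (l2Blocks) (l2Blocks) ((A₀′⁻¹N′∇′*_ν ⊗ 1)∘ρ(N′(s_κ⁻¹ − 1))) (C·e^{−δ|y−y′|_T})`.
[cite: Balaban1985BackgroundPropagators, Thm 3.1 (3.46) p.398 (sixth entry, shape); King1986, (2.13) p.653, (4.1)–(4.5) p.670] -/
theorem hasMajL2_tensorId_kingSOp_comp_divAdj (hLodd : Odd L) (hL : 2 ≤ L) {a : ℝ} (ha : 0 < a) {m0sq : ℝ} (hm0 : 0 ≤ m0sq) :
    ∃ C δ : ℝ, 0 < C ∧ 0 < δ ∧ ∀ (K : ℕ), 1 ≤ K → ∀ (n : ℕ) (e : ℕ) (M : Fin (d + 1) → ℕ) [∀ μ, NeZero (M μ)], (∀ μ, M μ = 2 * L ^ e) →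
      ∀ (msq : ℝ), 0 < msq → msq ≤ m0sq → ∀ (ν κ : Fin (d + 1)),
      HasMaj
        (TwoGrid.BlockNorm.l2Blocks (unitTorusGeo L K M) (fun i : Tor (fine (L ^ n * L ^ K) M) × Fin (d + 1) => blockOf (L ^ n * L ^ K) M i.1)
          (etaPow (L ^ n * L ^ K) (d + 1)) (etaPow_nonneg _ _))
        (TwoGrid.BlockNorm.l2Blocks (unitTorusGeo L K M) (fun i : Tor (fine (L ^ n * L ^ K) M) × Fin (d + 1) => blockOf (L ^ n * L ^ K) M i.1)
          (etaPow (L ^ n * L ^ K) (d + 1)) (etaPow_nonneg _ _))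
        (tensorId (Fin (d + 1)) (kingSOp L a msq (K + n) (L ^ n * L ^ K) M ν) ∘ₗ
          symbOp M (L ^ n * L ^ K) (((L ^ n * L ^ K : ℕ) : ℝ) • (sTinv M (L ^ n * L ^ K) κ - 1)))
        (fun y y' => C * Real.exp (-(δ * tdistT M y y'))) := by
  classical
  obtain ⟨C, δ, hC, hδ, H⟩ := fullPropAdjHessOp_l2_local (d := d) L hLodd hL ha hm0
  refine ⟨C, δ, hC, hδ, fun K hK n e M _ hM msq hmsq hcap ν κ => ?_⟩
  have hKn : 1 ≤ K + n := le_add_right hK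
  have hN : L ^ n * L ^ K = L ^ (K + n) := by rw [pow_add, mul_comm]
  intro y' f hf y
  set w : ℝ := etaPow (L ^ n * L ^ K) (d + 1) with hw
  have hw0 : 0 ≤ w := etaPow_nonneg _ _
  set T := tensorId (Fin (d + 1)) (kingSOp L a msq (K + n) (L ^ n * L ^ K) M ν) ∘ₗ
    symbOp M (L ^ n * L ^ K) (((L ^ n * L ^ K : ℕ) : ℝ) • (sTinv M (L ^ n * L ^ K) κ - 1)) with hT
  have hf' : ∀ p : Tor (fine (L ^ n * L ^ K) M) × Fin (d + 1), blockOf (L ^ n * L ^ K) M p.1 ≠ y' → f p = 0 := hf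
  have hE : 0 ≤ C * Real.exp (-(δ * tdistT M y y')) := mul_nonneg hC.le (Real.exp_nonneg _)
  -- colour by colour: Υ-c with the cut-off `𝟙_{B(y)}` (`H_h = 1`) and the source `f(·, i)` (supported in `B(y′)`)
  have hcol : ∀ i : Fin (d + 1),
      ∑ x ∈ univ.filter (fun x : Tor (fine (L ^ n * L ^ K) M) => blockOf (L ^ n * L ^ K) M x = y), T f (x, i) ^ 2
        ≤ (C * Real.exp (-(δ * tdistT M y y'))) ^ 2 *
          ∑ z ∈ univ.filter (fun z : Tor (fine (L ^ n * L ^ K) M) => blockOf (L ^ n * L ^ K) M z = y'), f (z, i) ^ 2 := by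
    intro i
    set h : Tor (fine (L ^ n * L ^ K) M) → ℝ := fun x => if blockOf (L ^ n * L ^ K) M x = y then 1 else 0 with hh
    have hh1 : ∀ x, |h x| ≤ 1 := fun x => by
      by_cases hx : blockOf (L ^ n * L ^ K) M x = y <;> simp [hh, hx]
    have hhsupp : ∀ x, h x ≠ 0 → blockOf (L ^ n * L ^ K) M x = y := fun x hx => by
      by_contra hx'
      exact hx (by simp [hh, hx'])
    have hfsupp : ∀ z, (fun z => f (z, i)) z ≠ 0 → blockOf (L ^ n * L ^ K) M z = y' := fun z hz => by
      by_contra hz'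
      exact hz (hf' (z, i) hz')
    have key := H (K + n) hKn (L ^ n * L ^ K) hN e M hM msq hmsq hcap ν κ (fun z => f (z, i)) h 1 y y' zero_le_one hh1 hhsupp hfsupp
    -- left side: the cut-off sum IS the block sum of `(T f)(·, i)²`
    have hlhs : ∑ x ∈ univ.filter (fun x : Tor (fine (L ^ n * L ^ K) M) => blockOf (L ^ n * L ^ K) M x = y), T f (x, i) ^ 2
        = ∑ x, (h x * ((fineOp (L ^ n * L ^ K) M (aK a L (K + n)) (((L ^ n * L ^ K : ℕ) : ℝ) ^ 2) msq)⁻¹ *ᵥ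
            (fun z => ((L ^ n * L ^ K : ℕ) : ℝ) ^ 2 * (f (z - unitVec (fine (L ^ n * L ^ K) M) ν - unitVec (fine (L ^ n * L ^ K) M) κ, i)
              - f (z - unitVec (fine (L ^ n * L ^ K) M) ν, i) - f (z - unitVec (fine (L ^ n * L ^ K) M) κ, i) + f (z, i)))) x) ^ 2 := by
      rw [← sum_filter_add_sum_filter_not univ (fun x : Tor (fine (L ^ n * L ^ K) M) => blockOf (L ^ n * L ^ K) M x = y)]
      have h0 : ∑ x ∈ univ.filter (fun x : Tor (fine (L ^ n * L ^ K) M) => ¬blockOf (L ^ n * L ^ K) M x = y),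
          (h x * ((fineOp (L ^ n * L ^ K) M (aK a L (K + n)) (((L ^ n * L ^ K : ℕ) : ℝ) ^ 2) msq)⁻¹ *ᵥ
            (fun z => ((L ^ n * L ^ K : ℕ) : ℝ) ^ 2 * (f (z - unitVec (fine (L ^ n * L ^ K) M) ν - unitVec (fine (L ^ n * L ^ K) M) κ, i)
              - f (z - unitVec (fine (L ^ n * L ^ K) M) ν, i) - f (z - unitVec (fine (L ^ n * L ^ K) M) κ, i) + f (z, i)))) x) ^ 2 = 0 :=
        sum_eq_zero fun x hx => by
          rw [mem_filter] at hx
          simp [hh, hx.2]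
      rw [h0, add_zero]
      refine sum_congr rfl fun x hx => ?_
      rw [mem_filter] at hx
      have hx1 : h x = 1 := by simp [hh, hx.2]
      rw [hx1, one_mul, hT, kingSOp_divAdj_colour_apply]
    -- right side: the full sum of `f(·, i)²` IS its block sum (support)
    have hrhs : ∑ z, f (z, i) ^ 2 = ∑ z ∈ univ.filter (fun z : Tor (fine (L ^ n * L ^ K) M) => blockOf (L ^ n * L ^ K) M z = y'), f (z, i) ^ 2 := by
      rw [← sum_filter_add_sum_filter_not univ (fun z : Tor (fine (L ^ n * L ^ K) M) => blockOf (L ^ n * L ^ K) M z = y')]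
      have h0 : ∑ z ∈ univ.filter (fun z : Tor (fine (L ^ n * L ^ K) M) => ¬blockOf (L ^ n * L ^ K) M z = y'), f (z, i) ^ 2 = 0 :=
        sum_eq_zero fun z hz => by
          rw [mem_filter] at hz
          rw [hf' (z, i) hz.2]
          ring
      rw [h0, add_zero]
    rw [hlhs, ← hrhs]
    simpa only [mul_one] using key
  -- sum the colours
  have hsq : (TwoGrid.BlockNorm.l2Blocks (unitTorusGeo L K M) (fun i : Tor (fine (L ^ n * L ^ K) M) × Fin (d + 1) => blockOf (L ^ n * L ^ K) M i.1) w hw0).loc y (T f) ^ 2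
      ≤ (C * Real.exp (-(δ * tdistT M y y')) *
          (TwoGrid.BlockNorm.l2Blocks (unitTorusGeo L K M) (fun i : Tor (fine (L ^ n * L ^ K) M) × Fin (d + 1) => blockOf (L ^ n * L ^ K) M i.1) w hw0).loc y' f) ^ 2 := by
    rw [mul_pow, sq_loc_l2Blocks, sq_loc_l2Blocks, sum_sq_filter_prod_eq, sum_sq_filter_prod_eq, mul_sum, mul_sum, mul_sum]
    refine sum_le_sum fun i _ => ?_
    have := hcol i
    calc w * ∑ x ∈ univ.filter (fun x : Tor (fine (L ^ n * L ^ K) M) => blockOf (L ^ n * L ^ K) M x = y), T f (x, i) ^ 2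
        ≤ w * ((C * Real.exp (-(δ * tdistT M y y'))) ^ 2 *
            ∑ z ∈ univ.filter (fun z : Tor (fine (L ^ n * L ^ K) M) => blockOf (L ^ n * L ^ K) M z = y'), f (z, i) ^ 2) :=
          mul_le_mul_of_nonneg_left this hw0
      _ = (C * Real.exp (-(δ * tdistT M y y'))) ^ 2 *
            (w * ∑ z ∈ univ.filter (fun z : Tor (fine (L ^ n * L ^ K) M) => blockOf (L ^ n * L ^ K) M z = y'), f (z, i) ^ 2) := by ring
  have hL0 := (TwoGrid.BlockNorm.l2Blocks (unitTorusGeo L K M) (fun i : Tor (fine (L ^ n * L ^ K) M) × Fin (d + 1) => blockOf (L ^ n * L ^ K) M i.1) w hw0).loc_nonneg y (T f)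
  have hR0 := (TwoGrid.BlockNorm.l2Blocks (unitTorusGeo L K M) (fun i : Tor (fine (L ^ n * L ^ K) M) × Fin (d + 1) => blockOf (L ^ n * L ^ K) M i.1) w hw0).loc_nonneg y' f
  exact (pow_le_pow_iff_left₀ hL0 (mul_nonneg hE hR0) two_ne_zero).mp hsq

/-! ## §2 ★★ The cell-oscillation row of the third entry, `L²`-block currency -/

/-- ★★ **THE CELL-OSCILLATION ROW OF `A₀⁻¹N∇*_ν` FOR KING's FULL `A = 0` PROPAGATOR, (coarse sup-block → fine `L²`-block) CURRENCY, HYPOTHESIS-FREE.**  For odd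
`L ≥ 3`, `a > 0`, a mass cap `m₀² ≥ 0`: `∃ δ C > 0` such that for every `K ≥ 1`, refinement `n`, cube `M_μ = 2L^e`, mass `0 < m² ≤ m₀²`, direction `ν` and every
coloured fine multiplier `c′` with `|c′| ≤ r`:
`HasMaj (ofBlocks (unitTorusGeo L K M) (blkFine L K M)) (l2Blocks … (blockOf (L^n·L^K) M ∘ fst) (η′^{d+1})) ((A₀′⁻¹N′∇′*_ν ⊗ 1)∘𝔇_{kingPrV}(M_{c′}, M_{blockAvg c′}))
(C·r·(L^K)⁻¹·e^{−δ|y−y′|_T})` — the pure second SOURCE difference of `A₀′⁻¹` summed over King's cells, paid through dag-n15-e's (3.46)₆ by dag-n15-a's mean-zero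
multiplier mechanism; NO letter on `∇c′`, uniform in `n`, the volume and the mass.  (The rung's located input for the dressed third entry of (3.42); sup edition =
FILE 65.) [cite: Balaban1985BackgroundPropagators, Thm 3.1 (3.42) p.397 (third entry, the row's consumer), (3.46) p.398 (sixth entry), (3.52) p.400 (first-order
species: shape); King1986, (2.13) p.653, (4.1)–(4.5) p.670, p.664 (pairing)] -/
theorem hasMajL2_kingSOp_comp_idef_mulOp_blockAvg (hLodd : Odd L) (hL : 2 ≤ L) {a : ℝ} (ha : 0 < a) {m0sq : ℝ} (hm0 : 0 ≤ m0sq) :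
    ∃ δ C : ℝ, 0 < δ ∧ 0 < C ∧ ∀ (K : ℕ), 1 ≤ K → ∀ (n : ℕ) (e : ℕ) (M : Fin (d + 1) → ℕ) [∀ μ, NeZero (M μ)], (∀ μ, M μ = 2 * L ^ e) →
      ∀ (msq : ℝ), 0 < msq → msq ≤ m0sq → ∀ (ν : Fin (d + 1)) (c' : Tor (fine (L ^ n * L ^ K) M) × Fin (d + 1) → ℝ) (r : ℝ), 0 ≤ r → (∀ z, |c' z| ≤ r) →
      HasMaj (BlockNorm.ofBlocks (unitTorusGeo L K M) (blkFine L K M))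
        (TwoGrid.BlockNorm.l2Blocks (unitTorusGeo L K M) (fun i : Tor (fine (L ^ n * L ^ K) M) × Fin (d + 1) => blockOf (L ^ n * L ^ K) M i.1)
          (etaPow (L ^ n * L ^ K) (d + 1)) (etaPow_nonneg _ _))
        (tensorId (Fin (d + 1)) (kingSOp L a msq (K + n) (L ^ n * L ^ K) M ν) ∘ₗ
          idef (pull (kingPrV L K n M)) (pull (kingPrV L K n M)) (mulOp c') (mulOp (blockAvg (kingPrV L K n M) c')))
        (fun y y' => C * r * (((L ^ K : ℕ) : ℝ))⁻¹ * Real.exp (-(δ * tdistT M y y'))) := by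
  obtain ⟨C, δ, hC, hδ, H⟩ := hasMajL2_tensorId_kingSOp_comp_divAdj (d := d) hLodd hL ha hm0
  refine ⟨δ, 2 * ((d : ℝ) + 1) * Real.sqrt ((d : ℝ) + 1) * C, hδ, by positivity, fun K hK n e M _ hM msq hmsq hcap ν c' r hr hc' => ?_⟩
  have hT := fun κ : Fin (d + 1) => H K hK n e M hM msq hmsq hcap ν κ
  refine (hasMaj_comp_idef_mulOp_blockAvg_of_divAdj_l2 M K n (fun y y' => mul_nonneg hC.le (Real.exp_nonneg _)) hr hc' hT).mono fun y y' => le_of_eq ?_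
  ring

end Main

end Summit.QuantumFields.YangMills.BalabanUVNodes.N15.KingModel.SrcDiv
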